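import Literature.NumberTheory.Automorphic.NewformAdelisationHeckeClassical
import Literature.NumberTheory.EllipticCurves.NewformsMainLemmaProofs
import HarnessLib

/-!
# Adelisation of classical modular forms, IV-b': the classical Hecke sum for an arbitrary cusp form
(`∑ⱼ f ∣[k] βⱼ⁻¹ = p^{2-k} T_p f`; Diamond–Shurman Prop. 5.2.1)

Topic `NumberTheory/Automorphic`; the operator-level form of `NewformAdelisationHeckeClassical`
(`sum_slash_heckeBeta_inv`, stated there for a newform with `T_p f = a_p f`, `⟨p⟩ f = χ(p) f`).
For the dictionary in the direction `φ ↦ f_φ` (Gelbart 1997, Prop. 2.5, converse) one needs the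
identity for *every* `f ∈ S_k(Γ₁(N))`, before any eigen-assumption:

* `sum_slash_heckeBeta_inv_eq_smul_heckeT` — **`∑ⱼ f ∣[k] βⱼ⁻¹ = p^{2-k} · T_p f`** for `p ∤ N` and
  Bezout data `a d' - b' N = 1`, `N ∣ a - p` (`βⱼ⁻¹ = p⁻¹ (1 -j; 0 p)`,
  `β_∞⁻¹ = p⁻¹ δ⁻¹ diag(p, 1)` with `δ⁻¹ ∈ Γ₀(N)` of lower right entry `a ≡ p`, so
  `f ∣ δ⁻¹ = ⟨a⟩ f = ⟨p⟩ f` by `coe_diamondOp_gamma0Map`, and Diamond–Shurman's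
  `T_p f = (⟨p⟩ f) ∣ diag(p, 1) + ∑ⱼ f ∣ (1 j; 0 p)`, `coe_heckeT_gamma1_eq_sum_of_not_dvd`);
* `sum_archLift_heckeBeta_inv_mul_eq` — the archimedean form
  **`∑ⱼ archLift k f (βⱼ⁻¹ x) = archLift k (T_p f) x / (√p)^{k-2}`** for `det x > 0`.

Everything is proved; no definitions.

## References

* F. Diamond, J. Shurman, *A first course in modular forms* (2005), §5.2, Prop. 5.2.1 and p. 168
  (diamond operators) [DiamondShurman2005].
* S. Gelbart, *Automorphic forms on adele groups* (1975), §3.B, Lemma 3.7 (proof) [Gelbart1975].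
-/

noncomputable section

open Matrix.GeneralLinearGroup UpperHalfPlane
open scoped MatrixGroups ModularForm

namespace Literature.NumberTheory.Automorphic

open EllipticCurves.ModularForms CongruenceSubgroup

section ClassicalSum

variable {N : ℕ} {k : ℤ} (p : ℕ) (hp : p.Prime) [NeZero p] (a b' d' : ℤ) (had : a * d' - b' * N = 1)

omit [NeZero p] in
/-- **`f ∣[k] δ⁻¹ = ⟨p⟩ f`** for the Bezout matrix `δ⁻¹ = (d' -b'; -N a) ∈ Γ₀(N)`, `a ≡ p (mod N)`,
and every `f ∈ S_k(Γ₁(N))` (Diamond–Shurman §5.2, p. 168: `⟨d⟩ f = f[α]_k` for any `α ∈ Γ₀(N)`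
with lower right entry `≡ d`; `coe_diamondOp_gamma0Map`). [cite: DiamondShurman2005, §5.2 p. 168] -/
theorem slash_bezoutDelta_inv_eq_diamondOp [NeZero N] (hap : (N : ℤ) ∣ a - p) (f : CuspForm (Gamma1 N) k) :
    (⇑f : ℍ → ℂ) ∣[k] ((((bezoutDelta a b' d' N had)⁻¹ : SL(2, ℤ)) : GL (Fin 2) ℝ)) =
      ⇑(diamondOp N k ((p : ℕ) : ZMod N) f) := by
  have h := coe_diamondOp_gamma0Map N k ⟨(bezoutDelta a b' d' N had)⁻¹, bezoutDelta_inv_mem_gamma0 a b' d' N had⟩ f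
  have hmap : Gamma0Map N ⟨(bezoutDelta a b' d' N had)⁻¹, bezoutDelta_inv_mem_gamma0 a b' d' N had⟩ = ((p : ℕ) : ZMod N) := by
    have h1 : Gamma0Map N ⟨(bezoutDelta a b' d' N had)⁻¹, bezoutDelta_inv_mem_gamma0 a b' d' N had⟩ = ((a : ℤ) : ZMod N) := by
      simp [Gamma0Map, bezoutDelta_inv_apply_one_one]
    rw [h1, ← Int.cast_natCast]
    exact ((ZMod.intCast_eq_intCast_iff_dvd_sub (p : ℤ) a N).2 hap).symm
  rw [hmap] at h
  exact h.symm

/-- **The classical Hecke sum for an arbitrary cusp form**: for `f ∈ S_k(Γ₁(N))`, `p ∤ N` prime and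
Bezout data `a d' - b' N = 1`, `N ∣ a - p`,
`∑ⱼ f ∣[k] βⱼ⁻¹ = p^{2-k} · T_p f` (Diamond–Shurman Prop. 5.2.1 with `⟨a⟩ = ⟨p⟩`; the eigenform case
is `sum_slash_heckeBeta_inv`). [cite: DiamondShurman2005, Prop. 5.2.1] -/
theorem sum_slash_heckeBeta_inv_eq_smul_heckeT [NeZero N] (hap : (N : ℤ) ∣ a - p) (hpN : ¬ p ∣ N)
    (f : CuspForm (Gamma1 N) k) :
    ∑ j : Option (Fin p), (⇑f : ℍ → ℂ) ∣[k] (Matrix.GeneralLinearGroup.map (Rat.castHom ℝ)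
        (heckeBeta p a b' d' N hp.ne_zero had j))⁻¹ =
      ((p : ℂ) ^ (2 - k)) • (⇑(heckeT (Gamma1 N) k p f) : ℍ → ℂ) := by
  -- the scalar `p⁻¹` contributes `p^{2-k}`
  have hscalar : (((p : ℝ)⁻¹ : ℝ) : ℂ) ^ (k - 2) = (p : ℂ) ^ (2 - k) := by
    push_cast
    rw [_root_.inv_zpow', neg_sub]
  -- the terms `j < p`
  have hsome : ∀ j : Fin p, (⇑f : ℍ → ℂ) ∣[k] (Matrix.GeneralLinearGroup.map (Rat.castHom ℝ)
      (heckeBeta p a b' d' N hp.ne_zero had (some j)))⁻¹ =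
      ((p : ℂ) ^ (2 - k)) • ((⇑f : ℍ → ℂ) ∣[k] tpB p (-((j : ℕ) : ℤ))) := fun j => by
    rw [map_castHom_heckeBeta_some_inv p hp a b' d' had j, slash_realScalarGL_mul, hscalar]
  -- the term `∞`
  have hnone : (⇑f : ℍ → ℂ) ∣[k] (Matrix.GeneralLinearGroup.map (Rat.castHom ℝ)
      (heckeBeta p a b' d' N hp.ne_zero had none))⁻¹ =
      ((p : ℂ) ^ (2 - k)) • ((⇑(diamondOp N k ((p : ℕ) : ZMod N) f) : ℍ → ℂ) ∣[k] tpD p) := by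
    rw [map_castHom_heckeBeta_none_inv p hp a b' d' had, slash_realScalarGL_mul, hscalar, SlashAction.slash_mul,
      slash_bezoutDelta_inv_eq_diamondOp p a b' d' had hap f]
  -- Diamond–Shurman's formula
  have hT : (⇑(heckeT (Gamma1 N) k p f) : ℍ → ℂ) =
      (⇑(diamondOp N k ((p : ℕ) : ZMod N) f) : ℍ → ℂ) ∣[k] tpD p + ∑ j : Fin p, (⇑f : ℍ → ℂ) ∣[k] tpB p ((j : ℕ) : ℤ) :=
    coe_heckeT_gamma1_eq_sum_of_not_dvd N k p hp hpN f
  -- assemble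
  rw [Fintype.sum_option, hnone]
  simp_rw [hsome]
  rw [← Finset.smul_sum, sum_slash_tpB_neg f p, ← smul_add, ← hT]

/-- **The archimedean form of the classical Hecke sum for an arbitrary cusp form**: for `det x > 0`,
`∑ⱼ archLift k f (βⱼ⁻¹ x) = archLift k (T_p f) x / (√p)^{k-2}` (`archLift k f (β⁻¹ x) =
(f ∣[k] β⁻¹ ∣[k] x)(i) (√(det x / p))^{2-k}` and `sum_slash_heckeBeta_inv_eq_smul_heckeT`; the
eigenform case is `sum_archLift_heckeBeta_inv_mul`). [cite: Gelbart1975, Lemma 3.7 (proof)] -/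
theorem sum_archLift_heckeBeta_inv_mul_eq [NeZero N] (hap : (N : ℤ) ∣ a - p) (hpN : ¬ p ∣ N)
    (f : CuspForm (Gamma1 N) k) {x : GL (Fin 2) ℝ} (hx : 0 < x.det.val) :
    ∑ j : Option (Fin p), archLift k f ((Matrix.GeneralLinearGroup.map (Rat.castHom ℝ)
        (heckeBeta p a b' d' N hp.ne_zero had j))⁻¹ * x) =
      archLift k (heckeT (Gamma1 N) k p f) x / (((Real.sqrt p : ℝ) : ℂ) ^ (k - 2)) := by
  have hp0 : (0 : ℝ) < p := by exact_mod_cast hp.pos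
  have hdetB : ∀ j, ((Matrix.GeneralLinearGroup.map (Rat.castHom ℝ) (heckeBeta p a b' d' N hp.ne_zero had j))⁻¹ * x).det.val =
      x.det.val / p := fun j => by
    rw [map_mul, map_inv, Units.val_mul, Units.val_inv_eq_inv_val, Matrix.GeneralLinearGroup.map_det, Units.coe_map,
      MonoidHom.coe_coe, val_det_heckeBeta, Rat.coe_castHom, Rat.cast_natCast, inv_mul_eq_div]
  have hterm : ∀ j, archLift k f ((Matrix.GeneralLinearGroup.map (Rat.castHom ℝ)
      (heckeBeta p a b' d' N hp.ne_zero had j))⁻¹ * x) =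
      (((⇑f : ℍ → ℂ) ∣[k] (Matrix.GeneralLinearGroup.map (Rat.castHom ℝ) (heckeBeta p a b' d' N hp.ne_zero had j))⁻¹) ∣[k] x)
        UpperHalfPlane.I * ((Real.sqrt (x.det.val / p) : ℝ) : ℂ) ^ (2 - k) := fun j => by
    rw [archLift_apply, SlashAction.slash_mul, hdetB, abs_of_pos (div_pos hx hp0)]
  simp_rw [hterm]
  rw [← Finset.sum_mul, ← Finset.sum_apply, ← finset_sum_slash,
    sum_slash_heckeBeta_inv_eq_smul_heckeT p hp a b' d' had hap hpN f,
    ModularForm.smul_slash, UpperHalfPlane.σ, if_pos hx, archLift_apply, abs_of_pos hx, Pi.smul_apply, smul_eq_mul]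
  change (p : ℂ) ^ (2 - k) * ((⇑(heckeT (Gamma1 N) k p f) : ℍ → ℂ) ∣[k] x) UpperHalfPlane.I * _ = _
  -- the powers of `√p`
  have hsp : (0 : ℝ) < Real.sqrt p := Real.sqrt_pos.2 hp0
  have hsp' : ((Real.sqrt p : ℝ) : ℂ) ≠ 0 := by exact_mod_cast hsp.ne'
  have hpC : (p : ℂ) = ((Real.sqrt p : ℝ) : ℂ) ^ (2 : ℤ) := by
    rw [zpow_two, ← Complex.ofReal_mul, Real.mul_self_sqrt hp0.le]; push_cast; ring
  rw [Real.sqrt_div' _ hp0.le, Complex.ofReal_div, div_zpow, hpC, ← _root_.zpow_mul]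
  have hkey : ((Real.sqrt p : ℝ) : ℂ) ^ (2 * (2 - k)) * (((Real.sqrt p : ℝ) : ℂ) ^ (2 - k))⁻¹ =
      (((Real.sqrt p : ℝ) : ℂ) ^ (k - 2))⁻¹ := by
    rw [← _root_.zpow_neg, ← _root_.zpow_neg, ← zpow_add₀ hsp']
    congr 1; ring
  rw [div_eq_mul_inv (((Real.sqrt x.det.val : ℝ) : ℂ) ^ (2 - k)), div_eq_mul_inv]
  calc ((Real.sqrt p : ℝ) : ℂ) ^ (2 * (2 - k)) * ((⇑(heckeT (Gamma1 N) k p f) : ℍ → ℂ) ∣[k] x) UpperHalfPlane.I *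
        (((Real.sqrt x.det.val : ℝ) : ℂ) ^ (2 - k) * (((Real.sqrt p : ℝ) : ℂ) ^ (2 - k))⁻¹)
      = ((⇑(heckeT (Gamma1 N) k p f) : ℍ → ℂ) ∣[k] x) UpperHalfPlane.I * ((Real.sqrt x.det.val : ℝ) : ℂ) ^ (2 - k) *
        (((Real.sqrt p : ℝ) : ℂ) ^ (2 * (2 - k)) * (((Real.sqrt p : ℝ) : ℂ) ^ (2 - k))⁻¹) := by ring
    _ = ((⇑(heckeT (Gamma1 N) k p f) : ℍ → ℂ) ∣[k] x) UpperHalfPlane.I * ((Real.sqrt x.det.val : ℝ) : ℂ) ^ (2 - k) *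
        (((Real.sqrt p : ℝ) : ℂ) ^ (k - 2))⁻¹ := by rw [hkey]

end ClassicalSum

end Literature.NumberTheory.Automorphic

end
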